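import Summits.NavierStokesRegularity.FluidComputer.PalasekTowerRegisterGlobalFloorsAt
import Summits.NavierStokesRegularity.FluidComputer.PalasekTowerRegisterGlobalLetterWitness

/-!
# REGISTER v2.3′: which level-`(k+1)` floors the level-`k` ceiling already admits — the PRE-LOAD witness
# (strain and core floors of the next level fit under the current ceiling; the speed floor never does)

Cell `ns-blowup`, seat `ns-palasek-19249-p2` (prover; D-0081 §C stub-worker on item
stmt-NavierStokesRegularity-19249 `HeredityAtOne`, stub `stub_readout_floors_one : ReadoutFloorsAt 1`, cut into
`SpeedFloorAt 1 ∧ StrainFloorAt 1 ∧ CoreFloorAt 1` in `PalasekTowerRegisterGlobalFloorsAt.lean`, p452333).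
Companion of `PalasekTowerRegisterGlobalLetterWitness.lean` (ecbridge-5 g4, p440747: the whole level-`m`
letter fits under the level-`m` ceiling — the cut-off solid rotation `(amp χ) J(y - c)` and its readings,
namespace `LetterWitness`). LABEL: E–C typing (KINEMATICS ONLY: one explicit smooth divergence-free field
per level and centre, and its register readings). WHAT THIS IS NOT: not Navier–Stokes evidence — the field
is a time-slice, not a solution; nothing is said about any continuation, no stage is constructed, no stub
is decided.

## What is proved, and why it matters for the three conjuncts of the lower stub

The lower stub asks of every tame continuation of a registered level-`k` stage the three level-`(k+1)`
floors AT `τ (k+1)`. At `τ k` the continuation coincides with the stage, whose register bounds the speed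
by the level-`k` CEILING `c₂ Y_k` but puts NO upper bound on gradients or on small-loop circulation
(the core clause is winding-blind, K57-W p432770). Hence the question «which of the three floors could a
registered level-`k` flow ALREADY carry at `τ k`?» is decided by the ceiling alone:

* `LetterWitness.exists_preloadWitness` (any rates `R`, level `m`, centre `c`): the cut-off solid rotation
  with `amp = A_m`, plateau radius `1/(2N_m)`, support radius `3/(5N_m)` is `C^∞`, divergence free,
  vanishes off `‖y - c‖ < 3/(5N_m)`, has sup norm `≤ (3/5)·Y_m`, gradient norm `≥ A_m` at `c`, and the
  circle of radius `1/(2N_m)` about `c` is a level-`m` core loop (inside `closedBall c (1/N_m)`, speed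
  `π/N_m ≤ 8π/N_m`) with circulation EXACTLY `(π/2)·N_m^{β-2} ≥ N_m^{β-2}`;
* `exists_strain_core_succ_under_ceiling` (rigid schedule, any `k` with `(3/5)·Y_{k+1} ≤ c₂·Y_k`, centre in
  the ball): a field meeting the STRAIN and CORE clauses of the level-`(k+1)` letter `Letter S (k+1)`
  while staying `≤ c₂·Y_k` everywhere — so it FAILS the level-`(k+1)` speed clause everywhere
  (`c₂ Y_k < c₁ Y_{k+1}` under the pins); at the first hand-over the hypothesis is the certified
  `(3/5)·Y₂ < (5/3)·Y₁` (`3684 < 4630`): **`exists_strain_core_two_under_ceiling_one`**;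
* `not_speedClause_succ_of_le_ceiling`: conversely NO field under the level-`k` ceiling meets the
  level-`(k+1)` speed clause (pins: `θ c₂ Y_k ≤ c₁ Y_{k+1}`, `θ = 6/5 > 1`).

READING for item 19249 (k = 1): of the three conjuncts of `ReadoutFloorsAt 1`, exactly ONE — the speed
floor `SpeedFloorAt 1` — is a JUMP that must be produced inside the window `(τ₁, τ₂]`
(`SpeedFloorAt.exists_jump_one`); the strain floor `A₂ = 4.07·A₁` and the `N₂`-core are compatible with
the level-1 register at `τ₁` (this file), i.e. they are claims of PERSISTENCE-OR-REGENERATION of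
scale-`1/N₂` structure across `≈ 37` diffusion times `1/N₂²`, not of amplitude growth. (Whether a
registered level-1 flow can actually carry such structure at `τ₁` is a reachability question — item 19179's
— on which kinematics is silent; the parabolic smoothing bound `‖Du(τ₁)‖ ≲ C·(c₂Y₁)²/ν ≈ 2.1·10⁷·C` from
the level-1 ceiling does not exclude `A₂ ≈ 5.0·10⁶`.)

References: A. J. Majda, A. L. Bertozzi, *Vorticity and Incompressible Flow*, CUP 2002, §1.2, §1.6 (1.57)
[cite: MajdaBertozziCUP2002, §1.2]; S. Palasek, arXiv:2605.13827 §3.1 [cite: Palasek2026ElementaryModel, §3.1].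
-/

noncomputable section

namespace Summit.NavierStokesRegularity.FluidComputer.PalasekTowerClayBridge

open Set MeasureTheory Filter Topology Function Real
open scoped ENNReal ContDiff NNReal InnerProductSpace RealInnerProductSpace
open Literature.Analysis.FluidPDE

namespace LetterWitness

/-- **THE PRE-LOAD WITNESS** (any rates `R`, level `m`, centre `c`): a `C^∞` divergence-free field on
`ℝ³` vanishing off `‖y - c‖ < 3/(5N_m)`, with sup norm `≤ (3/5)·Y_m`, gradient norm `≥ A_m` at `c`, and
the circle of radius `1/(2N_m)` about `c` a `C¹` closed loop inside `closedBall c (1/N_m)` of speed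
`π/N_m ≤ 8π/N_m` with circulation EXACTLY `(π/2)·N_m^{β-2}`. It is the cut-off solid rotation
`(A_m χ) J(y - c)`, `χ = smoothTransition (36/11 - (100/11) N_m² ‖y - c‖²)` (`χ = 1` on
`‖y - c‖ ≤ 1/(2N_m)`, `χ = 0` off `‖y - c‖ < 3/(5N_m)`). [cite: MajdaBertozziCUP2002, §1.2] -/
theorem exists_preloadWitness (R : TowerRates) (m : ℕ) (c : EuclideanSpace ℝ (Fin 3)) :
    ∃ v : EuclideanSpace ℝ (Fin 3) → EuclideanSpace ℝ (Fin 3),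
      ContDiff ℝ ∞ v ∧ VectorCalculus.IsDivFree v ∧
      (∀ y, 3 / (5 * R.N m) ≤ ‖y - c‖ → v y = 0) ∧
      (∀ y, ‖v y‖ ≤ 3 / 5 * R.Y m) ∧
      R.A m ≤ ‖fderiv ℝ v c‖ ∧
      (ContDiff ℝ 1 (circleLoop c (1 / (2 * R.N m)) (EuclideanSpace.single 0 1)
          (EuclideanSpace.single 1 1)) ∧
        circleLoop c (1 / (2 * R.N m)) (EuclideanSpace.single 0 1) (EuclideanSpace.single 1 1) 0 =
          circleLoop c (1 / (2 * R.N m)) (EuclideanSpace.single 0 1) (EuclideanSpace.single 1 1) 1 ∧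
        (∀ σ ∈ Icc (0 : ℝ) 1, circleLoop c (1 / (2 * R.N m)) (EuclideanSpace.single 0 1)
          (EuclideanSpace.single 1 1) σ ∈ Metric.closedBall c (1 / R.N m)) ∧
        (∀ σ ∈ Icc (0 : ℝ) 1, ‖deriv (circleLoop c (1 / (2 * R.N m)) (EuclideanSpace.single 0 1)
          (EuclideanSpace.single 1 1)) σ‖ ≤ 8 * π / R.N m) ∧
        circulation v (circleLoop c (1 / (2 * R.N m)) (EuclideanSpace.single 0 1)
          (EuclideanSpace.single 1 1)) = π / 2 * R.N m ^ (R.β - 2)) := by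
  have hN := R.N_pos m
  have hA := R.A_pos m
  have hY : 0 < R.Y m := Real.rpow_pos_of_pos hN _
  have hAY := R.A_eq_N_mul_Y m
  set N := R.N m with hNdef
  set amp : ℝ := R.A m with hampdef
  have hamp : 0 ≤ amp := hA.le
  set a : ℝ := 36 / 11 with hadef
  set b : ℝ := 100 / 11 * N ^ 2 with hbdef
  clear_value amp a b N
  have ha : (1 : ℝ) ≤ a := by norm_num [hadef]
  -- the cut-off is `1` on `‖y - c‖ ≤ 1/(2N)` and `0` off `‖y - c‖ < 3/(5N)`
  have hρ1 : 1 ≤ a - b * (1 / (2 * N)) ^ 2 := by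
    rw [hadef, hbdef]; field_simp; norm_num
  have hcut0 : ∀ y : EuclideanSpace ℝ (Fin 3), 3 / (5 * N) ≤ ‖y - c‖ → a - b * ‖y - c‖ ^ 2 ≤ 0 := by
    intro y hy
    have h1 : (3 / (5 * N)) ^ 2 ≤ ‖y - c‖ ^ 2 := pow_le_pow_left₀ (by positivity) hy 2
    have h2 : a = b * (3 / (5 * N)) ^ 2 := by rw [hadef, hbdef]; field_simp; norm_num
    have h3 : 0 ≤ b := by rw [hbdef]; positivity
    have h4 := mul_le_mul_of_nonneg_left h1 h3
    rw [h2]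
    linarith
  refine ⟨fun y => (amp * Real.smoothTransition (a - b * ‖y - c‖ ^ 2)) • rotGen (y - c),
    contDiff_field amp a b c, isDivFree_field amp a b c, fun y hy => field_apply_of_nonpos (hcut0 y hy),
    ?_, ?_, ⟨contDiff_circleLoop _ _ _ _, ?_, ?_, ?_, ?_⟩⟩
  · -- ceiling `(3/5) Y_m`
    intro y
    beta_reduce
    by_cases hy : 3 / (5 * N) ≤ ‖y - c‖
    · rw [field_apply_of_nonpos (hcut0 y hy), norm_zero]; positivity
    · refine (norm_field_le hamp a b c y).trans ?_
      have h1 : amp * ‖y - c‖ ≤ amp * (3 / (5 * N)) := mul_le_mul_of_nonneg_left (not_le.1 hy).le hamp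
      have h2 : amp * (3 / (5 * N)) = 3 / 5 * R.Y m := by
        rw [hAY]; field_simp
      linarith
  · -- strain floor `A_m` at the centre
    beta_reduce
    exact le_norm_fderiv_field_centre hamp ha b c
  · -- closed loop
    have h := periodic_circleLoop c (1 / (2 * N)) (EuclideanSpace.single (0 : Fin 3) (1 : ℝ))
      (EuclideanSpace.single 1 1) 0
    rw [zero_add] at h
    exact h.symm
  · -- inside `closedBall c (1/N)`
    intro σ _
    rw [Metric.mem_closedBall, dist_eq_norm, norm_circleLoop_sub_centre, abs_of_pos (by positivity)]
    rw [div_le_div_iff₀ (by positivity) hN]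
    linarith
  · -- loop speed `π/N ≤ 8π/N`
    intro σ _
    rw [norm_deriv_circleLoop, abs_of_pos (by positivity)]
    rw [show 2 * π * (1 / (2 * N)) = π / N by field_simp]
    exact div_le_div_of_nonneg_right (by nlinarith [Real.pi_pos]) hN.le
  · -- circulation `(π/2) N^{β-2}`
    beta_reduce
    rw [circulation_field_circleLoop c hρ1, hampdef, hNdef, ← R.A_div_N_sq m]
    field_simp

end LetterWitness

open LetterWitness

/-! ## Register reading: strain and core of level `k + 1` under the ceiling of level `k` -/

/-- **STRAIN AND CORE OF THE NEXT LEVEL FIT UNDER THE CURRENT CEILING** (rigid schedule on any rates: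
`c₁ = 1`, `c₂ = 5/3`; any level `k` with `(3/5)·Y_{k+1} ≤ c₂·Y_k`; any centre `c` in the ball). There is a
`C^∞` divergence-free field `v` with `‖v‖ ≤ c₂·Y_k` EVERYWHERE (the level-`k` ceiling) meeting the STRAIN
clause (`∃ x` in the ball, `c₁ A_{k+1} ≤ ‖Dv(x)‖`) and the CORE clause (a level-`(k+1)` core loop with
circulation `≥ c₁ N_{k+1}^{β-2}`) of the level-`(k+1)` letter. [cite: MajdaBertozziCUP2002, §1.2] -/
theorem exists_strain_core_succ_under_ceiling {R : TowerRates} {S : Schedule R} (hS : S.Rigid) (k : ℕ)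
    (hk : 3 / 5 * R.Y (k + 1) ≤ S.c₂ * R.Y k) {c : EuclideanSpace ℝ (Fin 3)} (hc : ‖c‖ ≤ S.radius) :
    ∃ v : EuclideanSpace ℝ (Fin 3) → EuclideanSpace ℝ (Fin 3),
      ContDiff ℝ ∞ v ∧ VectorCalculus.IsDivFree v ∧
      (∀ y, ‖v y‖ ≤ S.c₂ * R.Y k) ∧
      (∃ x, ‖x‖ ≤ S.radius ∧ S.c₁ * R.A (k + 1) ≤ ‖fderiv ℝ v x‖) ∧
      (∃ (x : EuclideanSpace ℝ (Fin 3)) (γ : ℝ → EuclideanSpace ℝ (Fin 3)),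
        ‖x‖ ≤ S.radius ∧ ContDiff ℝ 1 γ ∧ γ 0 = γ 1 ∧
        (∀ σ ∈ Icc (0 : ℝ) 1, γ σ ∈ Metric.closedBall x (1 / R.N (k + 1))) ∧
        (∀ σ ∈ Icc (0 : ℝ) 1, ‖deriv γ σ‖ ≤ 8 * π / R.N (k + 1)) ∧
        S.c₁ * R.N (k + 1) ^ (R.β - 2) ≤ circulation v γ) := by
  obtain ⟨v, hsm, hdiv, -, hsup, hstrain, hγ, hloop, hball, hspeed, hcirc⟩ :=
    exists_preloadWitness R (k + 1) c
  refine ⟨v, hsm, hdiv, fun y => (hsup y).trans hk, ⟨c, hc, ?_⟩, ⟨c, _, hc, hγ, hloop, hball, hspeed, ?_⟩⟩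
  · rw [hS.c₁_eq, one_mul]; exact hstrain
  · rw [hS.c₁_eq, one_mul, hcirc]
    have hpos : 0 < R.N (k + 1) ^ (R.β - 2) := Real.rpow_pos_of_pos (R.N_pos _) _
    nlinarith [Real.pi_gt_three]

/-- **NO field under the level-`k` ceiling meets the level-`(k+1)` SPEED clause** (pins `(Λ, θ)` with
`θ > 1`, any rates; `c₂ ≥ 0`): `θ·c₂·Y_k ≤ c₁·Y_{k+1}` makes `c₂·Y_k < c₁·Y_{k+1}`. [folklore] -/
theorem not_speedClause_succ_of_le_ceiling {R : TowerRates} {S : Schedule R} {Λ θ : ℝ} (hP : S.Pins Λ θ)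
    (hθ : 1 < θ) (hc₂ : 0 < S.c₂) (k : ℕ) {v : EuclideanSpace ℝ (Fin 3) → EuclideanSpace ℝ (Fin 3)}
    (hv : ∀ y, ‖v y‖ ≤ S.c₂ * R.Y k) :
    ¬ ∃ x, ‖x‖ ≤ S.radius ∧ S.c₁ * R.Y (k + 1) ≤ ‖v x‖ := by
  rintro ⟨x, -, hx⟩
  have hsep := hP.sep k
  have hY : 0 < R.Y k := Real.rpow_pos_of_pos (R.N_pos k) _
  have hpos : 0 < S.c₂ * R.Y k := mul_pos hc₂ hY
  have hlt : S.c₂ * R.Y k < θ * (S.c₂ * R.Y k) := lt_mul_left hpos hθ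
  linarith [hv x]

/-! ## The first hand-over `1 → 2` on the wide rates (item 19249) -/

/-- Certified: `(3/5)·Y₂ < (5/3)·Y₁` on the wide base (`Y₂ < 6140`, `2778 < Y₁`: `3684 < 4630`). [folklore] -/
theorem three_fifths_Y_two_lt_ceiling_one :
    3 / 5 * TowerRates.wide.Y 2 < 5 / 3 * TowerRates.wide.Y 1 := by
  have h1 := TowerRates.wide_Y_one_bounds.1
  have h2 := TowerRates.wide_Y_two_bounds.2
  linarith

/-- **AT THE FIRST HAND-OVER: the level-2 STRAIN floor and CORE floor fit under the level-1 ceiling, the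
level-2 SPEED floor does not.** For every rigid wide schedule and every centre `c` in its ball there is a
`C^∞` divergence-free field `v` with `‖v‖ < (5/3)·Y₁ = c₂·Y₁` everywhere (so `v` fails the speed clause of
`Letter S 2` everywhere: `‖v‖ < Y₂ = c₁·Y₂`) which meets the strain clause (`‖Dv(c)‖ ≥ A₂`) and the core
clause (an `N₂`-core loop of circulation `(π/2)·N₂^{3/10} ≥ N₂^{3/10}`) of `Letter S 2`. So among
`SpeedFloorAt 1`, `StrainFloorAt 1`, `CoreFloorAt 1` only the first is excluded from holding already at
`τ₁` by the level-1 register's ceiling. [cite: MajdaBertozziCUP2002, §1.2] -/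
theorem exists_strain_core_two_under_ceiling_one {S : Schedule TowerRates.wide} (hS : S.Rigid)
    {c : EuclideanSpace ℝ (Fin 3)} (hc : ‖c‖ ≤ S.radius) :
    ∃ v : EuclideanSpace ℝ (Fin 3) → EuclideanSpace ℝ (Fin 3),
      ContDiff ℝ ∞ v ∧ VectorCalculus.IsDivFree v ∧
      (∀ y, ‖v y‖ < S.c₂ * TowerRates.wide.Y 1) ∧
      (∀ y, ‖v y‖ < S.c₁ * TowerRates.wide.Y 2) ∧
      (∃ x, ‖x‖ ≤ S.radius ∧ S.c₁ * TowerRates.wide.A 2 ≤ ‖fderiv ℝ v x‖) ∧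
      (∃ (x : EuclideanSpace ℝ (Fin 3)) (γ : ℝ → EuclideanSpace ℝ (Fin 3)),
        ‖x‖ ≤ S.radius ∧ ContDiff ℝ 1 γ ∧ γ 0 = γ 1 ∧
        (∀ σ ∈ Icc (0 : ℝ) 1, γ σ ∈ Metric.closedBall x (1 / TowerRates.wide.N 2)) ∧
        (∀ σ ∈ Icc (0 : ℝ) 1, ‖deriv γ σ‖ ≤ 8 * π / TowerRates.wide.N 2) ∧
        S.c₁ * TowerRates.wide.N 2 ^ (TowerRates.wide.β - 2) ≤ circulation v γ) := by
  obtain ⟨v, hsm, hdiv, -, hsup, hstrain, hγ, hloop, hball, hspeed, hcirc⟩ :=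
    exists_preloadWitness TowerRates.wide 2 c
  have hlt := three_fifths_Y_two_lt_ceiling_one
  have hjump := speedFloor_two_gt_ceiling_one
  refine ⟨v, hsm, hdiv, fun y => ?_, fun y => ?_, ⟨c, hc, ?_⟩, ⟨c, _, hc, hγ, hloop, hball, hspeed, ?_⟩⟩
  · rw [hS.c₂_eq]; exact lt_of_le_of_lt (hsup y) hlt
  · rw [hS.c₁_eq, one_mul]; exact lt_of_le_of_lt (hsup y) (hlt.trans hjump)
  · rw [hS.c₁_eq, one_mul]; exact hstrain
  · rw [hS.c₁_eq, one_mul, hcirc]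
    have hpos : 0 < TowerRates.wide.N 2 ^ (TowerRates.wide.β - 2) :=
      Real.rpow_pos_of_pos (TowerRates.wide.N_pos _) _
    nlinarith [Real.pi_gt_three]

/-- The same, read as: at the first hand-over the strain-and-core part of the level-2 letter is met by a
field that is NOT a level-2 letter (its speed clause fails) and respects the level-1 ceiling — the three
conjuncts of `ReadoutFloorsAt 1` are kinematically independent of one another in this direction.
[cite: MajdaBertozziCUP2002, §1.2] -/
theorem exists_strain_core_not_letter_two {S : Schedule TowerRates.wide} (hS : S.Rigid)
    (hrad : 0 ≤ S.radius) :
    ∃ v : EuclideanSpace ℝ (Fin 3) → EuclideanSpace ℝ (Fin 3),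
      ContDiff ℝ ∞ v ∧ VectorCalculus.IsDivFree v ∧ (∀ y, ‖v y‖ < S.c₂ * TowerRates.wide.Y 1) ∧
      (∃ x, ‖x‖ ≤ S.radius ∧ S.c₁ * TowerRates.wide.A 2 ≤ ‖fderiv ℝ v x‖) ∧
      (∃ (x : EuclideanSpace ℝ (Fin 3)) (γ : ℝ → EuclideanSpace ℝ (Fin 3)),
        ‖x‖ ≤ S.radius ∧ ContDiff ℝ 1 γ ∧ γ 0 = γ 1 ∧
        (∀ σ ∈ Icc (0 : ℝ) 1, γ σ ∈ Metric.closedBall x (1 / TowerRates.wide.N 2)) ∧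
        (∀ σ ∈ Icc (0 : ℝ) 1, ‖deriv γ σ‖ ≤ 8 * π / TowerRates.wide.N 2) ∧
        S.c₁ * TowerRates.wide.N 2 ^ (TowerRates.wide.β - 2) ≤ circulation v γ) ∧
      ¬ Letter S 2 v := by
  obtain ⟨v, hsm, hdiv, hceil, hspeed, hstrain, hcore⟩ :=
    exists_strain_core_two_under_ceiling_one hS (c := 0) (by simpa using hrad)
  refine ⟨v, hsm, hdiv, hceil, hstrain, hcore, ?_⟩
  rintro ⟨⟨x, -, hx⟩, -, -⟩
  exact absurd hx (not_le.2 (hspeed x))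

end Summit.NavierStokesRegularity.FluidComputer.PalasekTowerClayBridge

end
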